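import Summits.CriticalPhenomena.PercolationContinuityZ3.Theorems.Transplant.SkelNegBParamsFaceLat
import Summits.CriticalPhenomena.PercolationContinuityZ3.Theorems.Transplant.SkelPhiFaceSlots2
import HarnessLib

/-!
# N1 params, chain of record `NegB`, part Face: THE (F) SLOT FLOOR `hkF` AT THE LEDGER — hp-8 g33's per-axis face half-width `kFF₂ (prF) fcells Rl I` satisfies
# `kFF₂ … I + 3 ≤ 5·r_(oth I)` for every `Rl ≤ RA′` at `g := gT` (the other (F) floor `hk₀'` is part FaceLat's `hk₀'_R`)

Derivation (stmt-g14 2026-08-21T18:49:57Z; `x := rdK I b`, `y := rdN I b = rdK J b`, `b := bOf I`, `J := oth I`, `M := Mabs`, `r := r_J`):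
`M·aw ≤ awNum + M − 1`, `awNum = (x(2r+1) + y)·D`, `xD·kF ≤ M(aw + Rl + 1) + y(Rl+2)D + xD − 1`, and the two lattice facts `y ≤ 3x` (FaceLat `rdN_le_three_rdK`) and
**`M ≤ 2xD`** (`800M = c_Ic_JD`, `c_JL_J ≤ D ≤ L_IL_J`, `c_IL_I ≤ 1600x`) give `xD(kF + 3) ≤ xD(2r + 5Rl + 18) − 2 < 5r·xD` as soon as `5Rl + 18 ≤ 3r` (`r ≥ K(6RA′+11)`).

builds on p205010 (kernel theorem, internal audit signed; external expert review pending) — nothing in this file uses p205010; NOTHING is claimed about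
the node `SamePDropOfSkeletonNeg₁` (OPEN).
Lane `prim-bschramm-*`, seat `prim-bschramm-stmt` (gen 14); helper file (`--supports stmt-CriticalPhenomena-4575 --as helper`); ledger HOME/prim-bschramm-stmt/NEG-PARAMS.md v0.13.
* §1 `modulus_le_Lhat_mul`, `D_le_L_mul`, **`Mabs_le_two_rdK_D`**, `awNum_eq`; §2 **`hkF_R`** (at `g := gT mk gx`, any `Rl ≤ RA′`).
[cite: KozmaNitzan2024, §4 Lemma 10 Step IV (pp. 20–21); Lemma 12 (pp. 23–25)] [cite: MartineauTassion2017, §4.3]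
-/

noncomputable section

open scoped Classical

namespace Summit.CriticalPhenomena.PercolationContinuityZ3.Theorems.Transplant

namespace PlanarSkeletonNeg

namespace NegB

open Literature.Probability.Percolation Literature.Probability.LatticeModels SimpleGraph
open Literature.Probability.Percolation.KozmaNitzan.Cells (oth)
open SkelConc (Consts)
open Skelφ.StepI (DataN)
open TwoAxis.Para (modulus)
open Neg

/-! ## §1 Lattice facts: `D ≤ L₀·L₁`, `Mabs ≤ 2·rdK_I·D`, `awNum` unfolded -/

section Lattice

variable (κ : Consts) {V : Type} [DecidableEq V] [Countable V] {G : SimpleGraph V} [G.LocallyFinite] (Φ : PlanarSkeletonNeg G) (t : V)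
  (p : unitInterval) (D : DataN V) (g f : ℕ)

/-- `m = n·v_β − h·v_L ≤ (|v_L| + |v_β|)·(|n| + |h|)`. [folklore] -/
theorem modulus_le_Lhat_mul : modulus (nL κ Φ t p D g f) (hL κ Φ t p D g f) (vL κ Φ t p D g f) (vβL κ Φ t p D g f) ≤
    (|vL κ Φ t p D g f| + |vβL κ Φ t p D g f|) * (|(nL κ Φ t p D g f : ℤ)| + |hL κ Φ t p D g f|) := by
  unfold TwoAxis.Para.modulus
  have h1 : (nL κ Φ t p D g f : ℤ) * vβL κ Φ t p D g f ≤ |(nL κ Φ t p D g f : ℤ)| * |vβL κ Φ t p D g f| := by rw [← abs_mul]; exact le_abs_self _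
  have h2 : -(hL κ Φ t p D g f * vL κ Φ t p D g f) ≤ |hL κ Φ t p D g f| * |vL κ Φ t p D g f| := by rw [← abs_mul]; exact neg_le_abs _
  nlinarith [abs_nonneg (vL κ Φ t p D g f), abs_nonneg (vβL κ Φ t p D g f), abs_nonneg (nL κ Φ t p D g f : ℤ), abs_nonneg (hL κ Φ t p D g f)]

/-- **`D ≤ L₀·L₁`** (`D = 800²·m`, `L₀ = 800(|v_L|+|v_β|)`, `L₁ = 800(|n|+|h|)`). [folklore] -/
theorem D_le_L_mul : (prF κ Φ t p D g f).D ≤ (prF κ Φ t p D g f).L 0 * (prF κ Φ t p D g f).L 1 := by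
  obtain ⟨hA, hn, hh, hvα, hvβ, -, -, hD⟩ := prF_fields κ Φ t p D g f
  have hm := modulus_le_Lhat_mul κ Φ t p D g f
  unfold Skelφ.FinePrm.L
  simp only [Skelφ.FinePrm.lvGen_zero_zero, Skelφ.FinePrm.lvGen_zero_one, Skelφ.FinePrm.lvGen_one_zero, Skelφ.FinePrm.lvGen_one_one, hA, hn, hh, hvα, hvβ,
    prF_D]
  unfold TwoAxis.Para.detD
  rw [show |(800 : ℤ)| = 800 by norm_num]
  have hm0 : 0 ≤ (|vL κ Φ t p D g f| + |vβL κ Φ t p D g f|) * (|(nL κ Φ t p D g f : ℤ)| + |hL κ Φ t p D g f|) := by positivity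
  nlinarith

/-- **`Mabs ≤ 2·rdK I (bOf I)·D`** for both level axes. [folklore] -/
theorem Mabs_le_two_rdK_D (hN : EqNumL κ Φ t p D g f) (I : Fin 2) :
    (prF κ Φ t p D g f).Mabs ≤ 2 * (prF κ Φ t p D g f).rdK I ((prF κ Φ t p D g f).bOf I) * (prF κ Φ t p D g f).D := by
  set pr := prF κ Φ t p D g f
  have hM := Mabs_eq κ Φ t p D g f hN
  have hDL := D_le_L_mul κ Φ t p D g f
  have hx := rdK_lower κ Φ t p D g f I
  have hJ := cL_upper κ Φ t p D g f hN (oth I)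
  have hDpos := (prF_pos κ Φ t p D g f hN).2.2.2.2.2
  obtain ⟨hc₀, hc₁⟩ := prF_c_pos κ Φ t p D g f
  have hcI : 0 < pr.cOf I := pr.cOf_pos hc₀ hc₁ I
  have hLJ : 0 < pr.L (oth I) := by
    have hnz := pr.lvGen_bOf_ne_zero (oth I) (pr.lvGen_ne_zero_of_detD_pos (prF_D κ Φ t p D g f) hDpos (oth I))
    have hA : pr.A = 800 := (prF_fields κ Φ t p D g f).1
    have hb : |pr.lvGen (oth I) (pr.bOf (oth I))| ≤ |pr.lvGen (oth I) 0| + |pr.lvGen (oth I) 1| := by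
      obtain h | h : pr.bOf (oth I) = 0 ∨ pr.bOf (oth I) = 1 := by
        generalize pr.bOf (oth I) = b; exact (by fin_cases b <;> simp)
      · rw [h]; linarith [abs_nonneg (pr.lvGen (oth I) 1)]
      · rw [h]; linarith [abs_nonneg (pr.lvGen (oth I) 0)]
    unfold Skelφ.FinePrm.L; rw [hA, show |(800 : ℤ)| = 800 by norm_num]
    have : 0 < |pr.lvGen (oth I) (pr.bOf (oth I))| := abs_pos.2 hnz
    linarith
  -- `c₀·c₁ = c_I·c_J` and `L 0 · L 1 = L_I · L_J`
  have hcc : pr.c₀ * pr.c₁ = pr.cOf I * pr.cOf (oth I) := by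
    obtain rfl | rfl : I = 0 ∨ I = 1 := by fin_cases I <;> simp
    · rw [Skelφ.FinePrm.cOf_zero, show oth (0 : Fin 2) = 1 from rfl, Skelφ.FinePrm.cOf_one]
    · rw [Skelφ.FinePrm.cOf_one, show oth (1 : Fin 2) = 0 from rfl, Skelφ.FinePrm.cOf_zero, mul_comm]
  have hLL : pr.L 0 * pr.L 1 = pr.L I * pr.L (oth I) := by
    obtain rfl | rfl : I = 0 ∨ I = 1 := by fin_cases I <;> simp
    · rw [show oth (0 : Fin 2) = 1 from rfl]
    · rw [show oth (1 : Fin 2) = 0 from rfl, mul_comm]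
  rw [hcc] at hM; rw [hLL] at hDL
  -- `800·M·L_J = c_I·(c_J L_J)·D ≤ c_I·D·D ≤ c_I·D·L_I·L_J ≤ 1600·x·D·L_J`
  have h1 : 800 * pr.Mabs * pr.L (oth I) ≤ pr.cOf I * pr.D * pr.D := by
    have : 800 * pr.Mabs * pr.L (oth I) = pr.cOf I * (pr.cOf (oth I) * pr.L (oth I)) * pr.D := by rw [hM]; ring
    rw [this]
    have hcD : 0 ≤ pr.cOf I * pr.D := by positivity
    nlinarith
  have h2 : pr.cOf I * pr.D * pr.D ≤ 1600 * pr.rdK I (pr.bOf I) * pr.D * pr.L (oth I) := by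
    have hcD : 0 ≤ pr.cOf I * pr.D := by positivity
    calc pr.cOf I * pr.D * pr.D ≤ pr.cOf I * pr.D * (pr.L I * pr.L (oth I)) := mul_le_mul_of_nonneg_left hDL hcD
      _ = (pr.cOf I * pr.L I) * pr.D * pr.L (oth I) := by ring
      _ ≤ (1600 * pr.rdK I (pr.bOf I)) * pr.D * pr.L (oth I) := by gcongr
      _ = 1600 * pr.rdK I (pr.bOf I) * pr.D * pr.L (oth I) := by ring
  have h3 : (800 * pr.Mabs) * pr.L (oth I) ≤ (1600 * pr.rdK I (pr.bOf I) * pr.D) * pr.L (oth I) := by linarith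
  have h4 := le_of_mul_le_mul_right h3 hLJ
  linarith

/-- **`awNum` unfolded**: `awNum (I, ·) = (rdK I b·(2r_J + 1) + rdN I b)·D`, `b := bOf I`, `J := oth I`. [folklore] -/
theorem awNum_eq (P : PCells2) (I : Fin 2) :
    (prF κ Φ t p D g f).awNum P (I, true) =
      ((prF κ Φ t p D g f).rdK I ((prF κ Φ t p D g f).bOf I) * (2 * (P.r (oth I) : ℤ) + 1) + (prF κ Φ t p D g f).rdN I ((prF κ Φ t p D g f).bOf I)) *
        (prF κ Φ t p D g f).D := by
  set pr := prF κ Φ t p D g f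
  obtain rfl | rfl : I = 0 ∨ I = 1 := by fin_cases I <;> simp
  · have e0 : P.faceExt ((0 : Fin 2), true) 0 = 0 := by simp [PCells2.faceExt]
    have e1 : P.faceExt ((0 : Fin 2), true) 1 = 2 * (P.r 1 : ℤ) := by simp [PCells2.faceExt, show oth (0 : Fin 2) = 1 from rfl]
    show (pr.rdK 1 (pr.bOf 0) * (P.faceExt (0, true) 0 + 1) + pr.rdK 0 (pr.bOf 0) * (P.faceExt (0, true) 1 + 1)) * pr.D = _
    rw [e0, e1, Skelφ.FinePrm.rdN_zero, Skelφ.FinePrm.rdK_one, show oth (0 : Fin 2) = 1 from rfl]; ring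
  · have e0 : P.faceExt ((1 : Fin 2), true) 0 = 2 * (P.r 0 : ℤ) := by simp [PCells2.faceExt, show oth (1 : Fin 2) = 0 from rfl]
    have e1 : P.faceExt ((1 : Fin 2), true) 1 = 0 := by simp [PCells2.faceExt]
    show (pr.rdK 1 (pr.bOf 1) * (P.faceExt (1, true) 0 + 1) + pr.rdK 0 (pr.bOf 1) * (P.faceExt (1, true) 1 + 1)) * pr.D = _
    rw [e0, e1, Skelφ.FinePrm.rdN_one, Skelφ.FinePrm.rdK_zero, show oth (1 : Fin 2) = 0 from rfl]; ring

end Lattice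

/-! ## §2 The (F) floor `hkF` at `g := gT` -/

section AtT

variable (κ : Consts) {V : Type} [DecidableEq V] [Countable V] {G : SimpleGraph V} [G.LocallyFinite] (Φ : PlanarSkeletonNeg G) (t : V)
  (p : unitInterval) (D : DataN V) (f mk : ℕ) (gx : Neg.FSlot)

/-- **`hkF`**: `kFF₂ (prF) fcells Rl I + 3 ≤ 5·r_(oth I)` for every `Rl ≤ RA′`, both axes, at `g := gT mk gx`. [cite: KozmaNitzan2024, §4 Lemma 10 Step IV] -/
theorem hkF_R (hN : EqNumL κ Φ t p D (KS.gT mk gx κ Φ t p D) f) (hκ : (hL κ Φ t p D (KS.gT mk gx κ Φ t p D) f).natAbs ≤ 10 * nL κ Φ t p D (KS.gT mk gx κ Φ t p D) f)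
    {Rl : ℕ} (hRl : Rl ≤ KS.RA' κ Φ t p D mk) (I : Fin 2) :
    (prF κ Φ t p D (KS.gT mk gx κ Φ t p D) f).kFF₂ (fcells κ Φ t p D (KS.gT mk gx κ Φ t p D) f) Rl I + 3 ≤
      5 * ((fcells κ Φ t p D (KS.gT mk gx κ Φ t p D) f).r (oth I) : ℤ) := by
  set pr := prF κ Φ t p D (KS.gT mk gx κ Φ t p D) f
  set P := fcells κ Φ t p D (KS.gT mk gx κ Φ t p D) f
  have hDpos := (prF_pos κ Φ t p D (KS.gT mk gx κ Φ t p D) f hN).2.2.2.2.2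
  obtain ⟨hc₀, hc₁⟩ := prF_c_pos κ Φ t p D (KS.gT mk gx κ Φ t p D) f
  have hDd := prF_D κ Φ t p D (KS.gT mk gx κ Φ t p D) f
  have hx : 0 < pr.rdK I (pr.bOf I) := rdK_pos_R κ Φ t p D _ f hN I
  have hM : 0 < pr.Mabs := pr.Mabs_pos hc₀ hc₁ hDd hDpos
  have hy0 : 0 ≤ pr.rdN I (pr.bOf I) := by
    unfold Skelφ.FinePrm.rdN; exact mul_nonneg (pr.cOf_pos hc₀ hc₁ (oth I)).le (abs_nonneg _)
  have hy : pr.rdN I (pr.bOf I) ≤ pr.rdK I (pr.bOf I) * 3 := rdN_le_three_rdK κ Φ t p D _ f hN I (eleven_le_s_T κ Φ t p D f mk gx hN hκ I)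
  have hM2 : pr.Mabs ≤ 2 * pr.rdK I (pr.bOf I) * pr.D := Mabs_le_two_rdK_D κ Φ t p D _ f hN I
  -- `r_J ≥ K(6RA'+11) ≥ 40(6Rl+11)`
  have hr : 40 * (6 * (Rl : ℤ) + 11) ≤ (P.r (oth I) : ℤ) := by
    obtain ⟨h0, h1⟩ := KS.r_geT κ Φ t p D mk gx f hN hκ
    have hK : (40 : ℤ) ≤ Neg.K κ := by exact_mod_cast (Neg.forty_le_K κ).1
    have hRl' : (Rl : ℤ) ≤ KS.RA' κ Φ t p D mk := by exact_mod_cast hRl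
    have hR0 : (0 : ℤ) ≤ Rl := by positivity
    obtain rfl | rfl : I = 0 ∨ I = 1 := by fin_cases I <;> simp
    · rw [show oth (0 : Fin 2) = 1 from rfl]; nlinarith
    · rw [show oth (1 : Fin 2) = 0 from rfl]; nlinarith
  -- the ceilings
  set aw := pr.awF₂ P (I, true) with haw
  have haw' : pr.Mabs * aw ≤ pr.awNum P (I, true) + pr.Mabs - 1 := by
    rw [haw]; unfold Skelφ.FinePrm.awF₂; exact Int.mul_ediv_self_le hM.ne'
  rw [awNum_eq] at haw'
  set x := pr.rdK I (pr.bOf I)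
  set y := pr.rdN I (pr.bOf I)
  set r := (P.r (oth I) : ℤ)
  have hxD : 0 < x * pr.D := mul_pos hx hDpos
  set q := pr.kFF₂ P Rl I with hq
  have hq' : x * pr.D * q ≤ pr.Mabs * (aw + Rl + 1) + y * (Rl + 2) * pr.D + x * pr.D - 1 := by
    rw [hq]; unfold Skelφ.FinePrm.kFF₂; exact Int.mul_ediv_self_le hxD.ne'
  -- combine
  have hR0 : (0 : ℤ) ≤ Rl := by positivity
  have hyR : y * ((Rl : ℤ) + 2) * pr.D ≤ x * 3 * ((Rl : ℤ) + 2) * pr.D := by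
    have : 0 ≤ ((Rl : ℤ) + 2) * pr.D := by positivity
    nlinarith
  have hMR : pr.Mabs * ((Rl : ℤ) + 2) ≤ 2 * x * pr.D * ((Rl : ℤ) + 2) := mul_le_mul_of_nonneg_right hM2 (by positivity)
  have key : x * pr.D * (q + 3) < x * pr.D * (5 * r) := by nlinarith
  have := lt_of_mul_lt_mul_left key hxD.le
  linarith

end AtT

end NegB

end PlanarSkeletonNeg

end Summit.CriticalPhenomena.PercolationContinuityZ3.Theorems.Transplant
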